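import Summits.Ventures.HSemireg.Pad4TowerPsiSubA1
import Summits.Ventures.HSemireg.Pad4TowerDiamondMu4
import Summits.Ventures.HSemireg.Pad4TowerRuleDMu4
import Summits.HodgeConjecture.HodgeConjecture.Cruxes.BlochSeedDiscOne.Anchor

/-!
# BlochSeedDiscOne — negation lens g3, LINE 3 (crux idea `letter-span-law`): ONE-LETTER ROWS — the per-factor LETTER-SPAN LAW
# «(A1) ∧ μ ≠ 0 ⇒ on EVERY factor the letters used are not μ-blind (β ∉ ⟨1, α, β̄, p⟩)»; adjacent-frame completions are μ-blind

HONEST FRAMING. Ideator sketch (planner `plan-lens-HodgeAV-negation` g3, LENSES-v3 lens «negation», director-hodge req-36) for the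
crux `Summit.HodgeConjecture.HodgeConjecture.Theses.EightfoldBlochSeeds.BlochSeedDiscOne` (item stmt-HodgeConjecture-18881; verbatim
`:= Literature.AlgebraicGeometry.HodgeTheory.HasHyperbolicBlochSeed 4 1`; skeleton `Lines/birth.lean` 814a6a70c14e831a, STUB R =
`stub_rung_pad4_seedAt`, screen (H1)). NOTHING HERE SAYS THAT HC ∕ HC_CM ∕ HC_AV ∕ H2 ∕ stmt-18881 HOLDS OR FAILS; HC_CM is a displayed
binder of the route only. This file is CLASS-LEVEL ONLY (the class screen (A1) of `Pad4TowerClassScreen` on the weighted class tensor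
`MConfig.wch` of `Pad4TowerPsiSubA1`): no variety, sheaf, σ, seed, static rule or SAT verdict is touched.

THE LEVER (negation key «assume STUB R's seed exists … construct the forced shape as a typed object s4-search-1 can encode, or the
typed obstruction»). Assume a first-order design passes (A1) with `μ = wch(eeee) ≠ 0`. Fix a factor `σ` and a letter slot
`c ∈ {1, u, v, ē, p}`; the word `e…e c e…e` (letter `c` at `σ`, `e` elsewhere) is e-mixed and is neither `eeee` nor `ēēēē`, so (A1)(i)
kills its coefficient, while `c = e` gives `μ` itself. Each such coefficient is `Σ_Z ε_Z m_Z · φ_c(x_{Z,σ}) · Π_{f ≠ σ} β_{Z,f}` — LINEAR in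
the σ-letter vector `φ(x_{Z,σ}) = (1, α, α, β, β̄, p)`. Hence (**LETTER-SPAN LAW**, `wch_eWord_eq_zero_of_letterRel`): if ONE
`ℤ[i]`-linear relation `Σ_c λ_c φ_c(x) = 0` with `λ_e ≠ 0` holds for every letter `x` occurring on factor `σ` (both levels), then
`μ = 0` FOR EVERY MULTIPLICITY VECTOR. Contrapositive = the FORCED SHAPE of a seed support: on every factor the occurring letters are
NOT μ-BLIND (`MuBlind`), i.e. `β ∉ span_{ℚ(i)}⟨1, α, β̄, α² − |β|²⟩` as functions on that letter set — a support-level predicate an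
encoder can impose clause by clause (per factor: «not inside a maximal μ-blind subset of the universe»).

COROLLARIES PROVED HERE (general weights, any letters in `ℤ × ℤ[i]` — axis or not):
* `wch_eWord_eq_zero_of_adapted`: a factor whose letters are all ADAPTED to one antipodal frame `{i^k, −i^k}` (`Pad4TowerRuleDMu4.Adapted`:
  rays ∕ towers of phases `± i^k` AND all apex letters `t·I`) is μ-blind (relation `β ∓ β̄ = 0`). This is the «one phase NO ∕ antipodal pair
  NO» column of gs-eng-2 RESULT 7 (card W2, class level (H1) by phase set, h1lin efb1a015313f22d5, computed in ◇₄) as a THEOREM at every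
  height, on ONE factor, for all multiplicities; it is NOT implied by LEMMA FC-CORE (`Pad4TowerFCCoreParitySeam.parity_weights_of_classScreen`
  needs axis FC cells on all factors and allows the odd core with one all-real factor).
* `wch_eWord_eq_zero_of_adjFrame`: a factor whose letters all lie in one ADJACENT-frame plane `InAdjFrame k` (`α = ±Re β ± Im β`: the
  box monoid `ℕ⟨ℓ_u, ℓ_{iu}⟩`, `u = i^k`, i.e. the rays of the two adjacent phases AND all their two-ray sums `aℓ_u + bℓ_{iu}` — the
  (F2) «multi-ray letters» named as residual in card v4.23 l.17 ∕ memo §7 RESIDUE R4) is μ-blind (relation `β = c_I(k)·α + c_E(k)·β̄`).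
  So the ADJACENT-FRAME COMPLETION `◇⁺` of a census universe adds NOTHING at class level frame by frame: two-ray letters can enter an
  (H1) design only on factors that also carry out-of-plane letters, where the law prices them (§6: `{ℓ₁, x, 2I, T₁}` and `{ℓ₁, ℓ_i, x, 2I}`
  are μ-blind by explicit `λ`, while the W7 seed alphabet `{ℓ₁, ℓ_i, 2I, T₁}` (b8eaa9e3e594b899) is not: `not_muBlind_w7`).
NUMERICAL CROSS-CHECK (this seat, exact modular rank at two primes, scripts `line3/classgate*.py` in the ideator HOME `line-3/`): class-level
(H1) feasible: `{ℓ₁,ℓ_i,2I,T₁}⁴` YES (control = W7); factor 0 restricted to `{ℓ₁,ℓ₋₁,2I,T₁}` (antipodal) NO, to `{ℓ₁,ℓ_i,x,x+ℓ₁}` (adjacent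
plane) NO, to `{2I,4I,x,2x}` NO, to `{ℓ₁,ℓ_i,x,2I}` NO, to `{ℓ₁,x,2I,T₁}` NO — each NO predicted by a `λ` of this file; single adjacent frame
`{O,ℓ₁,ℓ_i,x,2ℓ₁,2ℓ_i,x+ℓ₁,x+ℓ_i,2x}⁴` NO; `{O, ℓ_{±1}, ℓ_{±i}}⁴` YES; `{ℓ_{±1}, ℓ_{±i}, x_ζ}⁴` YES.

CONTENT. §1 one-letter words `oneLetter σ c` and their screen facts (`decide`). §2 `rest`, `ch_oneLetter` (the coefficient factorises through
the σ-letter). §3 the functional `oneRow σ λ` (linear), `oneRow_ch`, **`wch_eWord_eq_zero_of_letterRel`** (THE LAW) and its support form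
`not_muBlind_of_classScreen` (`lettersOn`, `MuBlind`); the MASTER FORM `wch_eWord_eq_zero_of_cellAnnihilator` (any cellwise annihilator vanishing on e-free words and `ēēēē` with `λ_{eeee} ≠ 0`). §4 frames: `InAdjFrame`, `lamAdj`, `lamAnt`, the two corollaries. §5 the completed universe: `l1Charge`,
`InDiamondPlus h` (`◇⁺_h`: ray monoid `|Re β|+|Im β| ≤ α`, even level, ℓ¹-height `≤ h`), `twoRay k = ℓ_{i^k} + ℓ_{i^{k+1}}`; kernel facts:
`◇_h ⊆ ◇⁺_h`, two-ray letters are in `◇⁺₄ ∖ ◇_h`, adapted to NO direction (so `RuleDMu4N∕P` impose nothing there, FLAG F-2), inside their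
adjacent plane; (rev 3) `wch_eWord_eq_zero_of_adjRaysNode` (`lamAdjNode`, `AdjRaysNode`, `rel_of_adjRaysNode`): rays of two ADJACENT phases +
origin + copies of ONE non-zero pure node `tI` on a factor ⇒ μ = 0 — with the antipodal corollary this is the 𝔄₇ PHASE RULE for LINE 2's flat alphabet
(every factor: ≥ 3 ray phases, or 2 adjacent phases with BOTH `2I` and `8I`). §6 certificates: `muBlind_adj_example`, `muBlind_lxIT`, `muBlind_llxI` (explicit `λ`, `decide`), `MuBlind.mono`,
`wch_eWord_eq_zero_of_lettersOn_subset` (ambient-alphabet support form), `muBlind_A1i_d4_minus_2I` (NODE FORCING at ◇₄: the W1 alphabet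
`𝒜_{1,i} ∩ ◇₄` minus the bare node `2I` is μ-blind ⇒ `2I` sits on EVERY factor of any (A1) ∧ μ ≠ 0 design there — census W2's «minimal reachable
letter sets all contain 2I» as a kernel fact; rev 2), `not_muBlind_w7`. Offline census (rev 2, HOME line-3/blind8m.py): maximal μ-blind subsets per factor
= 54 (◇₄) ∕ 1 314 (◇₆) ∕ 15 454 (◇₈; sizes 25²,16⁴⁰,11²⁴,10³¹²,9⁴,8¹⁶,7⁸⁰⁸,6⁶²⁴,5²⁰⁸⁰,4¹¹⁵⁴⁴) — complete by the rank-4 argument in the card.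
0 `sorry`. No `instance`, no notation, no new axiom.
-/

set_option linter.dupNamespace false

namespace Summit.HodgeConjecture.HodgeConjecture.Cruxes.BlochSeedDiscOne.LetterSpanLaw

open Finset Summit.Ventures.HSemireg.Pad4Tower Summit.Ventures.HSemireg.Pad4FirstOrder

/-! ## §1 One-letter words -/

/-- the word with letter `c` on factor `σ` and `e` (`3`) on the three other factors. -/
def oneLetter (σ : Fin 4) (c : Fin 6) : CWord :=
  ![![c, 3, 3, 3], ![3, c, 3, 3], ![3, 3, c, 3], ![3, 3, 3, c]] σ

/-- for `c ≠ e` the one-letter word is e-mixed and is neither `eeee` nor `ēēēē` — so (A1)(i) kills its coefficient. [`decide`] -/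
theorem oneLetter_screen : ∀ σ : Fin 4, ∀ c : Fin 6, c ≠ 3 →
    ¬ EFree (oneLetter σ c) ∧ oneLetter σ c ≠ eWord ∧ oneLetter σ c ≠ ebarWord := by
  decide

/-- `c = e` gives the μ-word itself. [`decide`] -/
theorem oneLetter_three : ∀ σ : Fin 4, oneLetter σ 3 = eWord := by decide

/-! ## §2 The coefficient of a one-letter word factorises through the σ-letter -/

/-- the product of the `e`-entries `β_f` of the three factors `f ≠ σ`. -/
def rest (Z : MCell) (σ : Fin 4) : GaussianInt :=
  ![bphi (Z 1) 3 * bphi (Z 2) 3 * bphi (Z 3) 3, bphi (Z 0) 3 * bphi (Z 2) 3 * bphi (Z 3) 3,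
    bphi (Z 0) 3 * bphi (Z 1) 3 * bphi (Z 3) 3, bphi (Z 0) 3 * bphi (Z 1) 3 * bphi (Z 2) 3] σ

/-- `ch(Z)(e…c…e) = φ_c(x_{Z,σ}) · Π_{f ≠ σ} β_{Z,f}`. -/
theorem ch_oneLetter (Z : MCell) (σ : Fin 4) (c : Fin 6) : Z.ch (oneLetter σ c) = bphi (Z σ) c * rest Z σ := by
  fin_cases σ <;> simp [MCell.ch, chTensor, oneLetter, rest] <;> ring

/-! ## §3 The one-row functional and THE LETTER-SPAN LAW -/

/-- the functional `T ↦ Σ_c λ_c · T(e…c…e)` (letter slot `c` at factor `σ`). -/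
def oneRow (σ : Fin 4) (lam : Fin 6 → GaussianInt) : (CWord → GaussianInt) →ₗ[GaussianInt] GaussianInt where
  toFun T := ∑ c, lam c * T (oneLetter σ c)
  map_add' T T' := by simp [mul_add, sum_add_distrib]
  map_smul' r T := by simp [mul_sum, mul_left_comm]

theorem oneRow_apply (σ : Fin 4) (lam : Fin 6 → GaussianInt) (T : CWord → GaussianInt) :
    oneRow σ lam T = ∑ c, lam c * T (oneLetter σ c) := rfl

/-- on a cell: `oneRow(ch Z) = (Σ_c λ_c φ_c(x_{Z,σ})) · Π_{f≠σ} β_{Z,f}`. -/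
theorem oneRow_ch (σ : Fin 4) (lam : Fin 6 → GaussianInt) (Z : MCell) :
    oneRow σ lam Z.ch = (∑ c, lam c * bphi (Z σ) c) * rest Z σ := by
  rw [oneRow_apply, sum_mul]
  refine sum_congr rfl fun c _ => ?_
  rw [ch_oneLetter, mul_assoc]

/-- a LETTER RELATION on factor `σ` of the support: one `ℤ[i]`-linear relation among the letter-vector entries
`(1, α, α, β, β̄, p)` holding for every letter occurring on factor `σ` (both levels). -/
def LetterRel (C : MConfig) (σ : Fin 4) (lam : Fin 6 → GaussianInt) : Prop :=
  ∀ Z, (Z ∈ C.lower ∨ Z ∈ C.upper) → ∑ c, lam c * bphi (Z σ) c = 0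

/-- **THE LETTER-SPAN LAW.** If the letters on some factor `σ` satisfy one linear relation with non-zero `e`-coefficient, then the class
screen (A1) forces `μ = wch(eeee) = 0` — for EVERY integer multiplicity vector. -/
theorem wch_eWord_eq_zero_of_letterRel (C : MConfig) (mN mP : MCell → ℤ) (σ : Fin 4) (lam : Fin 6 → GaussianInt)
    (h3 : lam 3 ≠ 0) (hrel : LetterRel C σ lam) (hA : ClassScreen (C.wch mN mP)) : C.wch mN mP eWord = 0 := by
  -- (1) the functional vanishes on the weighted class tensor, cell by cell
  have h0 : oneRow σ lam (C.wch mN mP) = 0 := by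
    have hl : ∀ Z ∈ C.lower, mN Z • oneRow σ lam Z.ch = 0 := fun Z hZ => by
      rw [oneRow_ch, hrel Z (Or.inl hZ), zero_mul, smul_zero]
    have hu : ∀ P ∈ C.upper, mP P • oneRow σ lam P.ch = 0 := fun P hP => by
      rw [oneRow_ch, hrel P (Or.inr hP), zero_mul, smul_zero]
    simp only [MConfig.wch, map_sub, map_sum, map_zsmul]
    rw [sum_eq_zero hl, sum_eq_zero hu, sub_zero]
  -- (2) by (A1)(i) only the `c = e` term survives: `oneRow(wch) = λ_e · μ`
  have h1 : oneRow σ lam (C.wch mN mP) = lam 3 * C.wch mN mP eWord := by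
    rw [oneRow_apply]
    have hz : ∀ c : Fin 6, c ≠ 3 → lam c * C.wch mN mP (oneLetter σ c) = 0 := fun c hc => by
      obtain ⟨hE, hne, hne'⟩ := oneLetter_screen σ c hc
      rw [hA.1 _ hE hne hne', mul_zero]
    rw [Fin.sum_univ_six, hz 0 (by decide), hz 1 (by decide), hz 2 (by decide), hz 4 (by decide), hz 5 (by decide),
      oneLetter_three]
    ring
  rw [h1] at h0
  exact (mul_eq_zero.mp h0).resolve_left h3

/-- **MASTER FORM (cellwise annihilator).** Any functional `T ↦ Σ_w λ_w T(w)` that vanishes on the e-free words and on `ēēēē`, has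
`λ_{eeee} ≠ 0`, and annihilates the class tensor of EVERY present cell individually, forces `μ = 0` under (A1) — for all weights. The
letter-span law is its instance `λ = Σ_c λ_c δ_{e…c…e}`; the pair ∕ triple laws of the card (letters free on two ∕ three factors) are the
instances supported on words with `e` on the complementary factors. -/
theorem wch_eWord_eq_zero_of_cellAnnihilator (C : MConfig) (mN mP : MCell → ℤ) (lam : CWord → GaussianInt)
    (he : lam eWord ≠ 0) (hfree : ∀ w, EFree w → lam w = 0) (hbar : lam ebarWord = 0)
    (hann : ∀ Z, (Z ∈ C.lower ∨ Z ∈ C.upper) → ∑ w, lam w * Z.ch w = 0) (hA : ClassScreen (C.wch mN mP)) :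
    C.wch mN mP eWord = 0 := by
  -- the functional as a linear map
  let L : (CWord → GaussianInt) →ₗ[GaussianInt] GaussianInt :=
    { toFun := fun T => ∑ w, lam w * T w
      map_add' := fun T T' => by simp [mul_add, sum_add_distrib]
      map_smul' := fun r T => by simp [mul_sum, mul_left_comm] }
  have hL : ∀ T, L T = ∑ w, lam w * T w := fun T => rfl
  have h0 : L (C.wch mN mP) = 0 := by
    have hl : ∀ Z ∈ C.lower, mN Z • L Z.ch = 0 := fun Z hZ => by rw [hL, hann Z (Or.inl hZ), smul_zero]
    have hu : ∀ P ∈ C.upper, mP P • L P.ch = 0 := fun P hP => by rw [hL, hann P (Or.inr hP), smul_zero]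
    simp only [MConfig.wch, map_sub, map_sum, map_zsmul]
    rw [sum_eq_zero hl, sum_eq_zero hu, sub_zero]
  have h1 : L (C.wch mN mP) = lam eWord * C.wch mN mP eWord := by
    rw [hL]
    refine Fintype.sum_eq_single eWord fun w hw => ?_
    by_cases hE : EFree w
    · rw [hfree w hE, zero_mul]
    · by_cases hb : w = ebarWord
      · rw [hb, hbar, zero_mul]
      · rw [hA.1 w hE hw hb, mul_zero]
  rw [h1] at h0
  exact (mul_eq_zero.mp h0).resolve_left he

/-- the letters occurring on factor `σ` of a configuration (both levels). -/
def lettersOn (C : MConfig) (σ : Fin 4) : Finset BPoint := (C.lower ∪ C.upper).image fun Z => Z σ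

/-- a finite letter set is μ-BLIND: it satisfies a linear relation with non-zero `e`-coefficient
(equivalently `β ∈ span_{ℚ(i)} ⟨1, α, β̄, α² − |β|²⟩` as functions on the set). -/
def MuBlind (S : Finset BPoint) : Prop :=
  ∃ lam : Fin 6 → GaussianInt, lam 3 ≠ 0 ∧ ∀ x ∈ S, ∑ c, lam c * bphi x c = 0

/-- **FORCED SHAPE (support form of the law).** (A1) with `μ ≠ 0` ⇒ on every factor the occurring letters are not μ-blind. -/
theorem not_muBlind_of_classScreen (C : MConfig) (mN mP : MCell → ℤ) (hA : ClassScreen (C.wch mN mP))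
    (hμ : C.wch mN mP eWord ≠ 0) (σ : Fin 4) : ¬ MuBlind (lettersOn C σ) := by
  rintro ⟨lam, h3, hS⟩
  refine hμ (wch_eWord_eq_zero_of_letterRel C mN mP σ lam h3 (fun Z hZ => hS _ ?_) hA)
  rcases hZ with hZ | hZ
  · exact mem_image.2 ⟨Z, mem_union_left _ hZ, rfl⟩
  · exact mem_image.2 ⟨Z, mem_union_right _ hZ, rfl⟩

/-! ## §4 Frames: one antipodal frame (adapted letters) or one adjacent-frame plane on a factor is μ-blind -/

/-- `x` lies in the plane of the ADJACENT frame `{i^k, i^{k+1}}`: `α = c`-combination spanned by `ℓ_{i^k}.pt = step k` and `step (k+1)`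
(`k = 0`: `α = Re β − Im β`; `1`: `α = −Re β − Im β`; `2`: `α = −Re β + Im β`; `3`: `α = Re β + Im β`). It contains the whole box monoid
`a·ℓ_{i^k} + b·ℓ_{i^{k+1}}` (`a, b ≥ 0`): the two rays AND all two-ray ((F2)) letters of the frame. Decidable. -/
abbrev InAdjFrame (k : Fin 4) (x : BPoint) : Prop :=
  x.1 = ![x.2.1 - x.2.2, -x.2.1 - x.2.2, -x.2.1 + x.2.2, x.2.1 + x.2.2] k

/-- the relation of the adjacent plane `k`: `c_I(k)·α − β + c_E(k)·β̄ = 0` with `c_I = (1−i, −1−i, −1+i, 1+i)_k`, `c_E = (i, −i, i, −i)_k`. -/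
def lamAdj (k : Fin 4) : Fin 6 → GaussianInt :=
  ![0, ![⟨1, -1⟩, ⟨-1, -1⟩, ⟨-1, 1⟩, ⟨1, 1⟩] k, 0, -1, ![⟨0, 1⟩, ⟨0, -1⟩, ⟨0, 1⟩, ⟨0, -1⟩] k, 0]

theorem lamAdj_three (k : Fin 4) : lamAdj k 3 ≠ 0 := by
  fin_cases k <;> decide

theorem rel_of_inAdjFrame (k : Fin 4) (x : BPoint) (hx : InAdjFrame k x) : ∑ c, lamAdj k c * bphi x c = 0 := by
  obtain ⟨a, r, s⟩ := x
  rw [Fin.sum_univ_six]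
  fin_cases k <;> simp [InAdjFrame] at hx <;> subst hx <;>
    simp [lamAdj, bphi, phiVec, Zsqrtd.ext_iff] <;> (try constructor) <;> (first | trivial | ring | omega)

/-- **a factor inside one adjacent-frame plane is μ-blind** (all weights). -/
theorem wch_eWord_eq_zero_of_adjFrame (C : MConfig) (mN mP : MCell → ℤ) (σ k : Fin 4)
    (hF : ∀ Z, (Z ∈ C.lower ∨ Z ∈ C.upper) → InAdjFrame k (Z σ)) (hA : ClassScreen (C.wch mN mP)) :
    C.wch mN mP eWord = 0 :=
  wch_eWord_eq_zero_of_letterRel C mN mP σ (lamAdj k) (lamAdj_three k) (fun Z hZ => rel_of_inAdjFrame k _ (hF Z hZ)) hA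

/-- relation vector for «rays of the two ADJACENT phases `i^k, i^{k+1}` (any multiples) + the origin + ONE pure node `tI`»:
`t·(c_I α − β + c_E β̄) − c_I·p` (on the rays `p = 0` and the adjacent-plane relation holds; on `tI` the two terms cancel). -/
def lamAdjNode (k : Fin 4) (t : ℤ) : Fin 6 → GaussianInt :=
  ![0, (t : GaussianInt) * ![⟨1, -1⟩, ⟨-1, -1⟩, ⟨-1, 1⟩, ⟨1, 1⟩] k, 0, -(t : GaussianInt),
    (t : GaussianInt) * ![⟨0, 1⟩, ⟨0, -1⟩, ⟨0, 1⟩, ⟨0, -1⟩] k, -(![⟨1, -1⟩, ⟨-1, -1⟩, ⟨-1, 1⟩, ⟨1, 1⟩] k)]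

theorem lamAdjNode_three (k : Fin 4) (t : ℤ) (ht : t ≠ 0) : lamAdjNode k t 3 ≠ 0 := by
  simp [lamAdjNode, Zsqrtd.ext_iff, ht]

/-- the letters allowed on an «adjacent-rays + one node» factor: the pure node `(t,0,0)`, or a letter of the adjacent-frame plane of
direction `k` lying on a coordinate axis (i.e. a ray `aℓ_{i^k}` or `bℓ_{i^{k+1}}`, or the origin). -/
def AdjRaysNode (k : Fin 4) (t : ℤ) (x : BPoint) : Prop :=
  x = (t, 0, 0) ∨ (InAdjFrame k x ∧ (x.2.1 = 0 ∨ x.2.2 = 0))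

theorem rel_of_adjRaysNode (k : Fin 4) (t : ℤ) (x : BPoint) (hx : AdjRaysNode k t x) :
    ∑ c, lamAdjNode k t c * bphi x c = 0 := by
  obtain ⟨a, r, s⟩ := x
  rw [Fin.sum_univ_six]
  rcases hx with h | ⟨hF, hrs⟩
  · simp only [Prod.mk.injEq] at h
    obtain ⟨rfl, rfl, rfl⟩ := h
    fin_cases k <;> simp [lamAdjNode, bphi, phiVec, Zsqrtd.ext_iff, sq, Zsqrtd.re_intCast, Zsqrtd.im_intCast, Zsqrtd.re_mul, Zsqrtd.im_mul] <;> ring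
  · fin_cases k <;> simp [InAdjFrame] at hF <;> subst hF <;> rcases hrs with h0 | h0 <;> simp only at h0 <;> subst h0 <;>
      simp [lamAdjNode, bphi, phiVec, Zsqrtd.ext_iff, sq, Zsqrtd.re_intCast, Zsqrtd.im_intCast, Zsqrtd.re_mul, Zsqrtd.im_mul] <;> ring

/-- **𝔄₇ PHASE RULE, adjacent case (rev 3; LINE 2's flat alphabet).** A factor whose letters are rays of (at most) two ADJACENT phases
`i^k, i^{k+1}` (any multiples, origin allowed) plus copies of ONE non-zero pure node `tI` is μ-blind: `μ = 0` under (A1) for all weights.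
With `wch_eWord_eq_zero_of_adapted` (≤ one phase or an antipodal pair + any nodes) this gives, for supports over
`𝔄₇ = {O, 2I, 8I} ∪ {aℓ_u : 1 ≤ a ≤ 4}`: every factor of an (A1) ∧ μ ≠ 0 design carries rays of ≥ 3 distinct phases, or rays of exactly
two ADJACENT phases together with BOTH nodes `2I` and `8I` (seat-local census `a7blind.py`: these are exactly the non-blind patterns;
the 342 maximal blind subsets of 𝔄₇ are the 2 antipodal sub-alphabets (11 letters), the 8 «adjacent rays + O + one of 2I∕8I» (10) and
smaller mixed sets). Pre-registered constraint for the W-FLAT-A7-D8 cell (kit 0; usable only per critic N3-3). -/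
theorem wch_eWord_eq_zero_of_adjRaysNode (C : MConfig) (mN mP : MCell → ℤ) (σ k : Fin 4) (t : ℤ) (ht : t ≠ 0)
    (hF : ∀ Z, (Z ∈ C.lower ∨ Z ∈ C.upper) → AdjRaysNode k t (Z σ)) (hA : ClassScreen (C.wch mN mP)) :
    C.wch mN mP eWord = 0 :=
  wch_eWord_eq_zero_of_letterRel C mN mP σ (lamAdjNode k t) (lamAdjNode_three k t ht)
    (fun Z hZ => rel_of_adjRaysNode k t _ (hF Z hZ)) hA

/-- the relation of the ANTIPODAL frame `{i^k, i^{k+2}}` (adapted letters, apex included): `β − β̄ = 0` (`k` even, `Im β = 0`) or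
`β + β̄ = 0` (`k` odd, `Re β = 0`). -/
def lamAnt (k : Fin 4) : Fin 6 → GaussianInt := ![0, 0, 0, 1, ![-1, 1, -1, 1] k, 0]

theorem lamAnt_three (k : Fin 4) : lamAnt k 3 ≠ 0 := by
  fin_cases k <;> decide

theorem rel_of_adapted (k : Fin 4) (x : BPoint) (hx : Adapted x k) : ∑ c, lamAnt k c * bphi x c = 0 := by
  obtain ⟨a, r, s⟩ := x
  rw [Fin.sum_univ_six]
  fin_cases k <;> simp [Adapted] at hx <;> subst hx <;> simp [lamAnt, bphi, phiVec, Zsqrtd.ext_iff]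

/-- **a factor inside one antipodal frame (all letters adapted to direction `k`, apex letters allowed) is μ-blind** (all weights) —
RESULT 7's «one phase NO, antipodal pair NO» at every height, one factor sufficing. -/
theorem wch_eWord_eq_zero_of_adapted (C : MConfig) (mN mP : MCell → ℤ) (σ k : Fin 4)
    (hF : ∀ Z, (Z ∈ C.lower ∨ Z ∈ C.upper) → Adapted (Z σ) k) (hA : ClassScreen (C.wch mN mP)) :
    C.wch mN mP eWord = 0 :=
  wch_eWord_eq_zero_of_letterRel C mN mP σ (lamAnt k) (lamAnt_three k) (fun Z hZ => rel_of_adapted k _ (hF Z hZ)) hA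

/-! ## §5 The completed universe `◇⁺_h` and the two-ray letters (dictionary to the census universes `◇_h`) -/

/-- the ℓ¹-charge `|Re β| + |Im β|` (= `absCharge` on axis letters). -/
abbrev l1Charge (x : BPoint) : ℤ := |x.2.1| + |x.2.2|

/-- **`x ∈ ◇⁺_h`**: the RAY MONOID `ℕ⟨ℓ₁, ℓ_i, ℓ₋₁, ℓ₋ᵢ⟩ = {|Re β| + |Im β| ≤ α, α ≡ |Re β| + |Im β| (mod 2)}` cut at ℓ¹-height `α + |Re β| + |Im β| ≤ h`
— the census diamond `◇_h` WITHOUT its axis condition: `◇_h` plus the interiors of the four adjacent frames. Decidable. -/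
abbrev InDiamondPlus (h : ℤ) (x : BPoint) : Prop :=
  l1Charge x ≤ x.1 ∧ (x.1 - l1Charge x) % 2 = 0 ∧ x.1 + l1Charge x ≤ h

/-- the TWO-RAY letter of the adjacent frame `k`: `x_k := ℓ_{i^k} + ℓ_{i^{k+1}}` (`α = 2`, `|β|² = 2`, `p = 2`: `(2, ±1, ±1)`). -/
abbrev twoRay (k : Fin 4) : BPoint := ray (step k) (k + 1) 1

/-- the four two-ray letters, explicitly. [`decide`] -/
theorem twoRay_val : twoRay 0 = (2, 1, -1) ∧ twoRay 1 = (2, -1, -1) ∧ twoRay 2 = (2, -1, 1) ∧ twoRay 3 = (2, 1, 1) := by decide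

/-- two-ray letters: in `◇⁺₄`, in NO census diamond `◇_h` (not axis letters), adapted to NO μ₄ direction (so the typed RULE D
`RuleDMu4N∕P` imposes nothing at such a factor — `Pad4TowerRuleDMu4` FLAG F-2), and inside their own adjacent plane. [`decide`] -/
theorem twoRay_facts : ∀ k : Fin 4, InDiamondPlus 4 (twoRay k) ∧ (∀ h : Fin 13, ¬ InDiamond (h : ℤ) (twoRay k)) ∧
    (∀ j : Fin 4, ¬ Adapted (twoRay k) j) ∧ InAdjFrame k (twoRay k) ∧ ¬ InAdjFrame (k + 1) (twoRay k) := by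
  decide

/-- the whole box monoid of an adjacent frame lies in its plane (so `wch_eWord_eq_zero_of_adjFrame` covers every (F2) letter of the frame). -/
theorem inAdjFrame_box (k : Fin 4) (a b : ℤ) (ha : 0 ≤ a) (hb : 0 ≤ b) : InAdjFrame k (ray (ray (0, 0, 0) k a) (k + 1) b) := by
  fin_cases k <;> simp [InAdjFrame, ray, abs_of_nonneg ha, abs_of_nonneg hb] <;> omega

/-- `◇_h ⊆ ◇⁺_h` (on axis letters `absCharge = l1Charge`). -/
theorem inDiamondPlus_of_inDiamond (h : ℤ) (x : BPoint) (hx : InDiamond h x) : InDiamondPlus h x := by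
  obtain ⟨a, r, s⟩ := x
  obtain ⟨hax, h1, h2, h3⟩ := hx
  have hc : absCharge (a, r, s) = l1Charge (a, r, s) := by
    rcases hax with h0 | ⟨-, h0⟩ | ⟨h0, -⟩
    · simp only [Prod.mk.injEq] at h0; obtain ⟨rfl, rfl⟩ := h0; simp [absCharge, chargeOf, l1Charge]
    · simp only at h0; subst h0; simp [absCharge, chargeOf, l1Charge]
    · simp only at h0; subst h0; simp [absCharge, chargeOf, l1Charge]
  refine ⟨?_, ?_, ?_⟩ <;> simp only [l1Charge] at hc ⊢ <;> rw [← hc] <;> assumption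

/-- on the box `α ≤ 8, |Re β|, |Im β| ≤ 8`: `◇₈ = ◇⁺₈ ∩ {axis or apex}` — the census universe is exactly the axis slice of the completed one,
and the complement `◇⁺₈ ∖ ◇₈` consists of letters with `Re β ≠ 0 ≠ Im β` (adjacent-frame interiors). [`decide`] -/
theorem diamond_eq_axis_slice : ∀ a : Fin 9, ∀ r s : Fin 17,
    let x : BPoint := ((a : ℤ), (r : ℤ) - 8, (s : ℤ) - 8)
    (InDiamond 8 x ↔ (InDiamondPlus 8 x ∧ (x.2 = (0, 0) ∨ AxisPt x))) := by
  decide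

/-! ## §6 Certificates: which small alphabets are μ-blind (explicit `λ`), and the W7 seed alphabet is not -/

/-- `ℓ₁ = (1,1,0)`, `ℓ_i = (1,0,−1)`, `x = ℓ₁ + ℓ_i = (2,1,−1)`, `2I = (2,0,0)`, `T₁ = 2I + ℓ₁ = (3,1,0)`, `x + ℓ₁ = (3,2,−1)`. -/
theorem muBlind_adj_example : MuBlind {(1, 1, 0), (1, 0, -1), (2, 1, -1), (3, 2, -1)} :=
  ⟨lamAdj 0, lamAdj_three 0, by decide⟩

/-- `{ℓ₁, x, 2I, T₁}` is μ-blind: `λ = (−4i, 4i, 0, 1, −1, −i)` (one ray + the two-ray letter + node + tower: rank 3, still blind). -/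
theorem muBlind_lxIT : MuBlind {(1, 1, 0), (2, 1, -1), (2, 0, 0), (3, 1, 0)} :=
  ⟨![⟨0, -4⟩, ⟨0, 4⟩, 0, 1, -1, ⟨0, -1⟩], by decide, by decide⟩

/-- `{ℓ₁, ℓ_i, x, 2I}` is μ-blind: `λ = (2−2i, −3+3i, 0, 1, −i, 1−i)`. -/
theorem muBlind_llxI : MuBlind {(1, 1, 0), (1, 0, -1), (2, 1, -1), (2, 0, 0)} :=
  ⟨![⟨2, -2⟩, ⟨-3, 3⟩, 0, 1, ⟨0, -1⟩, ⟨1, -1⟩], by decide, by decide⟩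

/-- `MuBlind` is monotone under inclusion (a relation on the big set restricts to the small one). -/
theorem MuBlind.mono {S T : Finset BPoint} (hTS : T ⊆ S) (hS : MuBlind S) : MuBlind T := by
  obtain ⟨lam, h3, hrel⟩ := hS
  exact ⟨lam, h3, fun x hx => hrel x (hTS hx)⟩

/-- Support form with an ambient alphabet: if factor `σ` only uses letters from a μ-blind set `S`, then `μ = 0` under (A1). -/
theorem wch_eWord_eq_zero_of_lettersOn_subset (C : MConfig) (mN mP : MCell → ℤ) (σ : Fin 4) (S : Finset BPoint)
    (hS : MuBlind S) (hsub : lettersOn C σ ⊆ S) (hA : ClassScreen (C.wch mN mP)) : C.wch mN mP eWord = 0 := by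
  by_contra hμ
  exact not_muBlind_of_classScreen C mN mP hA hμ σ (MuBlind.mono hsub hS)

/-- **NODE FORCING at ◇₄ (census W2 ∕ W1 explained as a theorem).** Inside the two-adjacent-phase alphabet
`𝒜_{1,i} ∩ ◇₄ = {O, 2I, 4I, ℓ_1, ℓ_i, 2ℓ_1, 2ℓ_i, T_1, T_i}` the eight letters OTHER than the bare node `2I` form a μ-blind set:
`β = (1 − i)α + iβ̄ − ((1 − i)/4)·p` on all of them (certificate `λ = (0, −4+4i, 0, 4, −4i, 1−i)`). Hence every weighted configuration on
`𝒜_{1,i} ∩ ◇₄` passing (A1) with `μ ≠ 0` uses the letter `2I` on EVERY factor (`wch_eWord_eq_zero_of_lettersOn_subset`) — the census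
observation «minimal reachable letter sets all contain the bare node 2I» (gs-eng-2 RESULT 7, `h1lin` efb1a015313f22d5) as a kernel fact, one
factor at a time. (Honest scope: at ◇₆ and ◇₈ no single letter of `𝒜_{1,i}` is forced — `w1alpha.py`.) -/
theorem muBlind_A1i_d4_minus_2I :
    MuBlind {(0, 0, 0), (4, 0, 0), (1, 1, 0), (1, 0, -1), (2, 2, 0), (2, 0, -2), (3, 1, 0), (3, 0, -1)} := by
  refine ⟨![0, ⟨-4, 4⟩, 0, 4, ⟨0, -4⟩, ⟨1, -1⟩], by decide, ?_⟩
  decide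

/-- **the W7 seed alphabet `{ℓ₁, ℓ_i, 2I, T₁}` (gs-eng-2 seed design b8eaa9e3e594b899) is NOT μ-blind**: every relation on it has `λ_e = 0`
(the towers satisfy `p = 4(α − 1)` with the rays, which is what leaves room for `β`). -/
theorem not_muBlind_w7 : ¬ MuBlind {(1, 1, 0), (1, 0, -1), (2, 0, 0), (3, 1, 0)} := by
  rintro ⟨lam, h3, hS⟩
  have e1 := hS (1, 1, 0) (by decide)
  have e2 := hS (1, 0, -1) (by decide)
  have e3 := hS (2, 0, 0) (by decide)
  have e4 := hS (3, 1, 0) (by decide)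
  rw [Fin.sum_univ_six] at e1 e2 e3 e4
  apply h3
  obtain ⟨a0, b0⟩ := lam 0
  obtain ⟨a1, b1⟩ := lam 1
  simp [bphi, phiVec, Zsqrtd.ext_iff] at e1 e2 e3 e4 ⊢
  omega

end Summit.HodgeConjecture.HodgeConjecture.Cruxes.BlochSeedDiscOne.LetterSpanLaw
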